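import Mathlib
import Summits.Ventures.PercRepro.TriangleCapBipartiteStar

/-!
# PercRepro — TWO BELOW THE DIAGONAL ON EVERY BIPARTITION: `Σ_v d(v)² + 2(k − 3) ≤ m·k` for every bipartite
spanning graph with at least two missing cross pairs and `m ≥ 2(k − 3)` (p3, gen 36; part 36)

TriangleCapBipartiteDeficit gives `Σ_v d(v)² + N₀ (k − N₀ − 1) ≤ m·k` for a bipartite spanning graph with `N₀`
missing cross pairs — the `r`-term of the closed form P3-TRIANGLE-CAP.md §10av on the bipartition whose product is
the least diagonal value above `m`, but nothing when `N₀ ≥ k − 1 − r` (the bipartition is «too big» for `m`: at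
`(12, 25)` the parts `(6, 6)` have `N₀ = 11` and the star bound reads `0`).  This module closes the case `r = 2`
on EVERY bipartition.  The deficit sum of a bipartite spanning graph is
`Σ deficit = 2 (Σ_{x ∈ X} miss(x)·d(x) + Σ_{y ∈ Xᶜ} miss(y)·d(y))` (`sum_deficit_eq_two_mul_of_bipartite`: every
missing cross pair `(x, y)` pays `d(x) + d(y)`), so

* when `N₀ ≤ k − 3` the star bound `N₀ (k − N₀ − 1) ≥ 2 (k − 3)` does it;
* when `N₀ ≥ k − 2` and no vertex is isolated, every missing pair pays `≥ 2`: `Σ deficit ≥ 4 N₀ ≥ 4 (k − 2)`;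
* when some vertex `z` is isolated, every vertex of the other side misses `z` and pays its degree:
  `Σ deficit ≥ 2 Σ_{y ∉ X} d(y) = 2m ≥ 4 (k − 3)` (`sum_deg_left_eq_card_edges`, `sum_deg_right_eq_card_edges`).

* **`bipartite_stability_two`** — `Σ_v d(v)² + 2 (k − 3) ≤ m·k` for every bipartite spanning graph with `N₀ ≥ 2`
  and `2 (k − 3) ≤ m`; in cherries `2·Σ_v C(d(v), 2) + 2m + 2 (k − 3) ≤ m·k` (`bipartite_stability_two_cherries`);
* **`two_below_diagonal_bipartite_exact`** — for `1 ≤ a`, `a + 2 ≤ k`, `m = a(k − a) − 2 ≥ 2 (k − 3)` with `m` and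
  `m + 1` not of the form `a′(k − a′)`: the maximum of `2·Σ_v C(d(v), 2)` over the bipartite spanning graphs on
  `Fin k` with `m` edges (ANY bipartition) IS `m (k − 2) − 2 (k − 3)`, attained by `K_{a, k−a}` minus two edges at one
  vertex (`bipMinusStar k a 2`) — the sub-diagonal `r = 2` of the closed form §10av on the bipartite class:
  `(8,13) 34 · (9,16) 50 · (10,22) 81 · (11,22) 91 · (12,25) 116 · …`.

Numbers first (mining/p3/g36/bip_ferrers.py): on every bipartition `(p, q)` of every `k ≤ 22` and every `m ≤ pq`
the exact maximum of `Σ_v d(v)²` over bipartite graphs (Ferrers shapes, by Kelmans compression) satisfies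
`Σ_v d(v)² + r (k − r − 1) ≤ m·k` with `r = δ_k(m) − m` — 5,563 cells, 0 violations, 2,100 equality cells.
Axioms: standard.
-/

namespace PercRepro

namespace TriangleCap

namespace C047

open Finset

variable {V : Type*} [Fintype V] [DecidableEq V]

/-- The neighbours of `x ∈ X` lie in `Xᶜ`: `d(x) + miss(x) = |Xᶜ|`. -/
theorem deg_add_miss_of_bipartite (D : SimpleGraph V) [DecidableRel D.Adj] (X : Finset V)
    (hbip : ∀ x y, D.Adj x y → (x ∈ X ↔ y ∉ X)) {x : V} (hx : x ∈ X) :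
    deg D x + miss D Xᶜ x = Xᶜ.card := by
  unfold deg miss
  have e : univ.filter (fun w => D.Adj x w) = Xᶜ.filter (fun w => D.Adj x w) := by
    ext w
    simp only [mem_filter, mem_univ, true_and, mem_compl]
    exact ⟨fun h => ⟨(hbip x w h).mp hx, h⟩, fun h => h.2⟩
  rw [e]
  exact card_filter_add_card_filter_not (s := Xᶜ) (fun w => D.Adj x w)

/-- The neighbours of `y ∉ X` lie in `X`: `d(y) + |{x ∈ X : ¬ x ~ y}| = |X|`. -/
theorem deg_add_missY_of_bipartite (D : SimpleGraph V) [DecidableRel D.Adj] (X : Finset V)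
    (hbip : ∀ x y, D.Adj x y → (x ∈ X ↔ y ∉ X)) {y : V} (hy : y ∉ X) :
    deg D y + (X.filter (fun x => ¬ D.Adj x y)).card = X.card := by
  unfold deg
  have e : univ.filter (fun w => D.Adj y w) = X.filter (fun x => D.Adj x y) := by
    ext w
    simp only [mem_filter, mem_univ, true_and]
    constructor
    · intro h
      refine ⟨?_, h.symm⟩
      by_contra hw
      exact hy ((hbip y w h).mpr hw)
    · intro h
      exact h.2.symm
  rw [e]
  exact card_filter_add_card_filter_not (s := X) (fun x => D.Adj x y)

/-- **EVERY MISSING CROSS PAIR PAYS THE DEGREES OF ITS ENDS:**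
`Σ deficit = 2 (Σ_{x ∈ X} miss(x)·d(x) + Σ_{y ∉ X} miss(y)·d(y))` on a bipartite spanning graph. -/
theorem sum_deficit_eq_two_mul_of_bipartite (D : SimpleGraph V) [DecidableRel D.Adj] (X : Finset V)
    (hbip : ∀ x y, D.Adj x y → (x ∈ X ↔ y ∉ X)) :
    ∑ p ∈ adjPairsAll D, deficit D p =
      2 * (∑ x ∈ X, miss D Xᶜ x * deg D x +
        ∑ y ∈ Xᶜ, (X.filter (fun x => ¬ D.Adj x y)).card * deg D y) := by
  have h := sum_deficit_add_eq_of_bipartite D X hbip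
  have h1 : ∀ x ∈ X, miss D Xᶜ x * deg D x + miss D Xᶜ x * miss D Xᶜ x = miss D Xᶜ x * Xᶜ.card := by
    intro x hx
    rw [← Nat.mul_add, deg_add_miss_of_bipartite D X hbip hx]
  have h2 : ∀ y ∈ Xᶜ, (X.filter (fun x => ¬ D.Adj x y)).card * deg D y +
      (X.filter (fun x => ¬ D.Adj x y)).card * (X.filter (fun x => ¬ D.Adj x y)).card =
      (X.filter (fun x => ¬ D.Adj x y)).card * X.card := by
    intro y hy
    rw [← Nat.mul_add, deg_add_missY_of_bipartite D X hbip (mem_compl.mp hy)]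
  have s1 := sum_congr rfl h1
  have s2 := sum_congr rfl h2
  rw [sum_add_distrib, ← sum_mul, ← card_missing_left] at s1
  rw [sum_add_distrib, ← sum_mul, ← card_missing_right] at s2
  have hk := card_add_card_compl X
  have e : (missing D X Xᶜ).card * Xᶜ.card + (missing D X Xᶜ).card * X.card =
      Fintype.card V * (missing D X Xᶜ).card := by rw [← hk]; ring
  omega

/-- `Σ_{y ∉ X} d(y) = m` on a bipartite spanning graph (the mirror of `sum_deg_left_eq_card_edges`). -/
theorem sum_deg_right_eq_card_edges (D : SimpleGraph V) [DecidableRel D.Adj] (X : Finset V)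
    (hbip : ∀ x y, D.Adj x y → (x ∈ X ↔ y ∉ X)) :
    ∑ y ∈ Xᶜ, deg D y = D.edgeFinset.card := by
  have hbip' : ∀ x y, D.Adj x y → (x ∈ Xᶜ ↔ y ∉ Xᶜ) := by
    intro x y hxy
    have h := hbip x y hxy
    simp only [mem_compl]
    constructor
    · intro hx
      by_contra hy
      exact hx (h.mpr hy)
    · intro hy hx
      exact hy (h.mp hx)
  exact sum_deg_left_eq_card_edges D Xᶜ hbip'

omit [DecidableEq V] in
/-- A vertex of degree `0` has no neighbour. -/
theorem not_adj_of_deg_eq_zero (D : SimpleGraph V) [DecidableRel D.Adj] {z : V} (hz : deg D z = 0) (w : V) :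
    ¬ D.Adj z w := by
  intro hw
  unfold deg at hz
  rw [card_eq_zero, filter_eq_empty_iff] at hz
  exact hz (mem_univ w) hw

/-- **TWO BELOW THE DIAGONAL ON EVERY BIPARTITION:** a bipartite spanning graph on `k` vertices with `m ≥ 2(k − 3)`
edges and at least two missing cross pairs has `Σ_v d(v)² + 2 (k − 3) ≤ m·k`. -/
theorem bipartite_stability_two (D : SimpleGraph V) [DecidableRel D.Adj] (X : Finset V)
    (hbip : ∀ x y, D.Adj x y → (x ∈ X ↔ y ∉ X)) (hN : 2 ≤ (missing D X Xᶜ).card)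
    (hm : 2 * (Fintype.card V - 3) ≤ D.edgeFinset.card) :
    ∑ v, deg D v * deg D v + 2 * (Fintype.card V - 3) ≤ D.edgeFinset.card * Fintype.card V := by
  have hid := two_mul_sum_deg_sq_add_sum_deficit D
  rw [card_triangles3_eq_zero_of_cliqueFree D (cliqueFree_of_bipartite D X hbip)] at hid
  have hid2 : 2 * ∑ v, deg D v * deg D v + ∑ p ∈ adjPairsAll D, deficit D p =
      2 * (D.edgeFinset.card * Fintype.card V) := by rw [hid]; ring
  suffices h : 4 * (Fintype.card V - 3) ≤ ∑ p ∈ adjPairsAll D, deficit D p by omega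
  have hG := sum_deficit_eq_two_mul_of_bipartite D X hbip
  by_cases hNk : (missing D X Xᶜ).card + 3 ≤ Fintype.card V
  · -- the star bound: `N₀ (k − N₀ − 1) ≥ 2 (k − 3)` for `2 ≤ N₀ ≤ k − 3`
    have h1 := sum_deficit_ge_of_bipartite D X hbip
    obtain ⟨N, hN'⟩ : ∃ N, (missing D X Xᶜ).card = N + 2 := ⟨(missing D X Xᶜ).card - 2, by omega⟩
    obtain ⟨j, hj⟩ : ∃ j, Fintype.card V = N + 2 + 1 + (j + 2) := ⟨Fintype.card V - N - 5, by omega⟩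
    rw [hN', hj] at h1
    rw [hj]
    have e1 : N + 2 + 1 + (j + 2) - (N + 2) - 1 = j + 2 := by omega
    have e2 : N + 2 + 1 + (j + 2) - 3 = N + j + 2 := by omega
    rw [e1] at h1
    rw [e2]
    nlinarith
  · -- `N₀ ≥ k − 2`
    by_cases hiso : ∃ z, deg D z = 0
    · obtain ⟨z, hz⟩ := hiso
      have hzadj := not_adj_of_deg_eq_zero D hz
      by_cases hzX : z ∈ X
      · -- every `y ∉ X` misses `z` and pays `d(y)`
        have h1 : ∀ y ∈ Xᶜ, deg D y ≤ (X.filter (fun x => ¬ D.Adj x y)).card * deg D y := by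
          intro y _
          have hpos : 0 < (X.filter (fun x => ¬ D.Adj x y)).card :=
            card_pos.mpr ⟨z, mem_filter.mpr ⟨hzX, hzadj y⟩⟩
          exact Nat.le_mul_of_pos_left _ hpos
        have h2 := sum_le_sum h1
        rw [sum_deg_right_eq_card_edges D X hbip] at h2
        omega
      · -- every `x ∈ X` misses `z` and pays `d(x)`
        have hzXc : z ∈ Xᶜ := mem_compl.mpr hzX
        have h1 : ∀ x ∈ X, deg D x ≤ miss D Xᶜ x * deg D x := by
          intro x _
          have hpos : 0 < miss D Xᶜ x := by
            unfold miss
            exact card_pos.mpr ⟨z, mem_filter.mpr ⟨hzXc, fun h => hzadj x h.symm⟩⟩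
          exact Nat.le_mul_of_pos_left _ hpos
        have h2 := sum_le_sum h1
        rw [sum_deg_left_eq_card_edges D X hbip] at h2
        omega
    · -- no isolated vertex: every missing pair pays at least `2`
      have hpos : ∀ z, 0 < deg D z := fun z => Nat.pos_of_ne_zero (fun h => hiso ⟨z, h⟩)
      have h1 : ∀ x ∈ X, miss D Xᶜ x ≤ miss D Xᶜ x * deg D x :=
        fun x _ => Nat.le_mul_of_pos_right _ (hpos x)
      have h2 : ∀ y ∈ Xᶜ, (X.filter (fun x => ¬ D.Adj x y)).card ≤
          (X.filter (fun x => ¬ D.Adj x y)).card * deg D y :=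
        fun y _ => Nat.le_mul_of_pos_right _ (hpos y)
      have s1 := sum_le_sum h1
      have s2 := sum_le_sum h2
      rw [← card_missing_left] at s1
      rw [← card_missing_right] at s2
      omega

/-- `bipartite_stability_two` in cherries: `2·Σ_v C(d(v), 2) + 2m + 2 (k − 3) ≤ m·k`. -/
theorem bipartite_stability_two_cherries (D : SimpleGraph V) [DecidableRel D.Adj] (X : Finset V)
    (hbip : ∀ x y, D.Adj x y → (x ∈ X ↔ y ∉ X)) (hN : 2 ≤ (missing D X Xᶜ).card)
    (hm : 2 * (Fintype.card V - 3) ≤ D.edgeFinset.card) :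
    2 * cherries D + 2 * D.edgeFinset.card + 2 * (Fintype.card V - 3) ≤
      D.edgeFinset.card * Fintype.card V := by
  have h1 := bipartite_stability_two D X hbip hN hm
  have h2 := two_mul_cherries_add D
  have h3 := sum_deg_eq D
  omega

/-- **TWO BELOW THE DIAGONAL, BIPARTITE, EXACT:** for `1 ≤ a`, `a + 2 ≤ k`, `m = a(k − a) − 2 ≥ 2 (k − 3)` with `m` and
`m + 1` not of the form `a′(k − a′)`, the maximum of `2·Σ_v C(d(v), 2)` over the bipartite spanning graphs on `Fin k`
with `m` edges — ANY bipartition — is `m (k − 2) − 2 (k − 3)`, attained by `K_{a, k−a}` minus two edges at one vertex. -/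
theorem two_below_diagonal_bipartite_exact (k a : ℕ) (ha : 1 ≤ a) (hak : a + 2 ≤ k)
    (hdense : 2 * (k - 3) ≤ a * (k - a) - 2)
    (hm : ∀ a', a' ≤ k → a * (k - a) - 2 ≠ a' * (k - a') ∧ a * (k - a) - 1 ≠ a' * (k - a')) :
    (∀ (D : SimpleGraph (Fin k)) [DecidableRel D.Adj] (X : Finset (Fin k)),
        (∀ x y, D.Adj x y → (x ∈ X ↔ y ∉ X)) →
        D.edgeFinset.card = a * (k - a) - 2 →
        2 * cherries D + 2 * (k - 3) ≤ (a * (k - a) - 2) * (k - 2)) ∧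
      ∃ (D : SimpleGraph (Fin k)) (_ : DecidableRel D.Adj) (X : Finset (Fin k)),
        (∀ x y, D.Adj x y → (x ∈ X ↔ y ∉ X)) ∧
        D.edgeFinset.card = a * (k - a) - 2 ∧ 2 * cherries D + 2 * (k - 3) = (a * (k - a) - 2) * (k - 2) := by
  have hka : 2 ≤ a * (k - a) := by
    obtain ⟨c, hc⟩ : ∃ c, k = a + 2 + c := ⟨k - a - 2, by omega⟩
    subst hc
    have : a + 2 + c - a = 2 + c := by omega
    rw [this]
    nlinarith
  obtain ⟨m, hmm⟩ : ∃ m, a * (k - a) = m + 2 := ⟨a * (k - a) - 2, by omega⟩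
  have e1 : a * (k - a) - 2 = m := by omega
  have e2 : a * (k - a) - 1 = m + 1 := by omega
  rw [e1] at hdense hm ⊢
  rw [e2] at hm
  constructor
  · intro D _ X hbip hD
    have hcard : Fintype.card (Fin k) = k := Fintype.card_fin k
    -- the bipartition has at least two missing pairs: its product is neither `m` nor `m + 1`
    have hNX := card_missing_add_card_edges D X hbip
    have hXc : Xᶜ.card = k - X.card := by
      have := card_add_card_compl X
      rw [hcard] at this
      omega
    have hXk : X.card ≤ k := by
      have := card_le_univ X
      rwa [hcard] at this
    obtain ⟨h1, h2⟩ := hm X.card hXk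
    rw [hXc] at hNX
    have hN : 2 ≤ (missing D X Xᶜ).card := by
      rw [hD] at hNX
      by_contra hlt
      have : (missing D X Xᶜ).card = 0 ∨ (missing D X Xᶜ).card = 1 := by omega
      rcases this with h | h
      · rw [h] at hNX; exact h1 (by omega)
      · rw [h] at hNX; exact h2 (by omega)
    have := bipartite_stability_two_cherries D X hbip hN (by rw [hcard, hD]; exact hdense)
    rw [hcard, hD] at this
    -- `2 c + 2 m + 2 (k − 3) ≤ m k` gives `2 c + 2 (k − 3) ≤ m (k − 2)`
    obtain ⟨k', hk'⟩ : ∃ k', k = k' + 3 := ⟨k - 3, by omega⟩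
    subst hk'
    have e3 : k' + 3 - 3 = k' := by omega
    have e4 : k' + 3 - 2 = k' + 1 := by omega
    rw [e3] at this ⊢
    rw [e4]
    nlinarith
  · refine ⟨bipMinusStar k a 2, inferInstance, univ.filter (fun i : Fin k => i.val < a),
      bipMinusStar_bipartite k a 2, ?_, ?_⟩
    · have := card_edges_bipMinusStar k a 2 ha hak
      omega
    · have h := two_mul_cherries_bipMinusStar k a 2 ha hak (by omega)
      rw [hmm] at h
      -- `2 c + 2 (2k − 5) = (m + 2)(k − 2)` gives `2 c + 2 (k − 3) = m (k − 2)`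
      obtain ⟨k', hk'⟩ : ∃ k', k = k' + 3 := ⟨k - 3, by omega⟩
      subst hk'
      have e3 : k' + 3 - 3 = k' := by omega
      have e4 : k' + 3 - 2 = k' + 1 := by omega
      have e5 : 2 * (k' + 3) - 2 - 3 = 2 * k' + 1 := by omega
      rw [e4, e5] at h
      rw [e3, e4]
      nlinarith

end C047

end TriangleCap

end PercRepro
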